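import Summits.CriticalPhenomena.CardyFormulaZ2.Theorems.CardyIKTransportIKMixedBoxCrossingQuenchedDefs
import Summits.CriticalPhenomena.CardyFormulaZ2.Theorems.CardyIKTransportIKMixedBoxCrossingQuenchedGlueStep
import Summits.CriticalPhenomena.CardyFormulaZ2.Theorems.CardyIKTransportIKMixedBoxCrossingQuenchedBottomRow
import Summits.CriticalPhenomena.CardyFormulaZ2.Theorems.CardyIKTransportIKLinearTransportFarRSWAllAspects

/-!
# Stub `stub_rswAssembly` (line `defect-closure-exploration` v7, crux `IKMixedBoxCrossing`, stmt-CriticalPhenomena-5911)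

Support file (`--supports stmt-CriticalPhenomena-5911`): the strategist's RSW ASSEMBLY of skeleton v7,
`RSWAssembly : IsotropyFloorAll → ApproxHarris7 → Split.HorizontalClause` (registered signature
`stub_rswAssembly`).  No symmetry and no positive association of the annealed field is used.

Proof.  Through the definitional bridge `Split.horizontalClause_iff` the goal is a uniform floor
`c ≤ pLR S a b (2n) n` (`1 ≤ n`).  Let `δ` be the isotropy floor of the squares, `c_V` the landed
all-aspect vertical floor at aspect `2` (`verticalClause_aspect 2`, p146877), `η := δ⁴ c_V³ / 2` and `n₀` the
scale of approximate Harris for the seven glue events at deficit `η`.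
* LARGE SCALES `n ≥ max n₀ 2` (`large`): the seven factors of `glueProduct` are `≥ δ` (four squares) and `≥ c_V`
  (three overlap strips, at most twice as tall as wide by `overlap_aspect`), so `glueProduct ≥ δ⁴ c_V³`
  (`glueProduct_ge`); approximate Harris gives `μ(glueEvent) ≥ δ⁴ c_V³ / 2`; and the seven events glue to a
  black LR crossing of the `2n × n` box (`glueEvent_subset`: three applications of the landed planar glue step
  `glueStep`, p163709, at shifts `s, 2s, n`, `s = ⌈n/3⌉`), so `pLR S a b (2n) n ≥ δ⁴ c_V³ / 2` by monotonicity.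
* SMALL SCALES `1 ≤ n < max n₀ 2`: the all-black bottom row, `pLR S a b (2n) n ≥ 2^{-2n} ≥ 2^{-2 max(n₀,2)}`
  (`bottomRowFloor`, landed sibling stub `stub_bottomRowFloor`, `…QuenchedBottomRow`).
The constant is `min (δ⁴ c_V³ / 2) (2^{-2 max(n₀,2)})`.
-/

noncomputable section

namespace Summit.CriticalPhenomena.CardyFormulaZ2.Cruxes.IKMixedBoxCrossing.QuenchedChainFKG

open MeasureTheory
open Summit.CriticalPhenomena.CardyFormulaZ2.Theorems.IKLinearTransport.PinnedDiagramExchange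
  (Ω μIK Obs obs lrCross tbCross CouplingToLimits.isProbabilityMeasure_μIK)
open Summit.CriticalPhenomena.CardyFormulaZ2.Theorems.IKLinearTransport.PinnedDiagramExchange.FarRSWAllAspects
  (verticalClause_aspect)
open Summit.CriticalPhenomena.CardyFormulaZ2.Cruxes.IKMixedBoxCrossing.PairedMirrorExploration (pLR pTB)

namespace RSWAssemblyProof

/-! ## §1 The planar glue of the seven events -/

/-- **THE GLUE**: for `2 ≤ n`, the seven glue events imply a black LR crossing of the `2n × n` box — three
applications of `glueStep` at the shifts `s`, `2s`, `n` (`s = ⌈n/3⌉`, `1 ≤ s`, `2s ≤ n`), through the BT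
crossings of the overlap strips of widths `n − s`, `n − s`, `2s`. -/
theorem glueEvent_subset {n : ℕ} (hn : 2 ≤ n) (S : Set ℤ) (a b : ℤ) :
    glueEvent S n a b ⊆ obs S ⁻¹' lrCross a b (2 * n) n := by
  intro ω hω
  simp only [glueEvent, Set.mem_preimage, Set.mem_inter_iff] at hω ⊢
  obtain ⟨⟨⟨⟨⟨⟨h1, h2⟩, h3⟩, h4⟩, h5⟩, h6⟩, h7⟩ := hω
  have hs1 : 1 ≤ glueShift n := one_le_glueShift (by omega)
  have hs2 : 2 * glueShift n ≤ n := two_mul_glueShift_le hn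
  -- step 1: squares `0` and `s` through the strip `[a+s, a+n)`
  have e1 : obs S ω ∈ lrCross a b (glueShift n + n) n :=
    glueStep (obs S ω) a b (glueShift n) n n n (by omega) (by omega) h1 h2 h5
  -- step 2: the `(s+n)`-wide box and square `2s` through the strip `[a+2s, a+n)`
  have e2 : obs S ω ∈ lrCross a b (2 * glueShift n + n) n := by
    refine glueStep (obs S ω) a b (2 * glueShift n) (glueShift n + n) n n (by omega) (by omega) e1 ?_ ?_
    · push_cast; exact h3
    · rw [show glueShift n + n - 2 * glueShift n = n - glueShift n by omega]
      push_cast; exact h6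
  -- step 3: the `(2s+n)`-wide box and square `n` through the strip `[a+n, a+2s+n)`
  have e3 : obs S ω ∈ lrCross a b (n + n) n := by
    refine glueStep (obs S ω) a b n (2 * glueShift n + n) n n (by omega) (by omega) e2 h4 ?_
    rw [show 2 * glueShift n + n - n = 2 * glueShift n by omega]
    exact h7
  rwa [two_mul]

/-! ## §2 The product of the seven floors -/

/-- Monotonicity of a product of two nonnegative lower bounds. -/
theorem mul_ge {a b x y : ℝ} (ha : 0 ≤ a) (hb : 0 ≤ b) (hx : a ≤ x) (hy : b ≤ y) : a * b ≤ x * y :=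
  mul_le_mul hx hy hb (ha.trans hx)

/-- **THE SEVEN FLOORS**: with squares crossed with probability `≥ δ` and boxes at most twice as tall as wide
crossed bottom-to-top with probability `≥ c_V`, `glueProduct ≥ δ⁴ c_V³` for `2 ≤ n`. -/
theorem glueProduct_ge {δ cV : ℝ} (hδ : 0 ≤ δ) (hcV : 0 ≤ cV)
    (hI : ∀ S : Set ℤ, ∀ n : ℕ, 1 ≤ n → ∀ a b : ℤ, δ ≤ pLR S a b n n)
    (hV : ∀ (S : Set ℤ) (a b : ℤ) (w h : ℕ), 1 ≤ w → 1 ≤ h → h ≤ 2 * w → cV ≤ pTB S a b w h)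
    {n : ℕ} (hn : 2 ≤ n) (S : Set ℤ) (a b : ℤ) : δ ^ 4 * cV ^ 3 ≤ glueProduct S n a b := by
  have hn1 : 1 ≤ n := by omega
  have hov := overlap_aspect hn
  have hq1 : cV ≤ pTB S (a + glueShift n) b (n - glueShift n) n := hV S _ b _ _ (by omega) hn1 hov.1
  have hq2 : cV ≤ pTB S (a + 2 * glueShift n) b (n - glueShift n) n := hV S _ b _ _ (by omega) hn1 hov.1
  have hq3 : cV ≤ pTB S (a + n) b (2 * glueShift n) n := hV S _ b _ _ (by omega) hn1 hov.2
  rw [show δ ^ 4 * cV ^ 3 = δ * δ * δ * δ * cV * cV * cV by ring, glueProduct]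
  exact mul_ge (by positivity) hcV (mul_ge (by positivity) hcV (mul_ge (by positivity) hcV
    (mul_ge (by positivity) hδ (mul_ge (by positivity) hδ (mul_ge hδ hδ (hI S n hn1 a b) (hI S n hn1 _ b))
      (hI S n hn1 _ b)) (hI S n hn1 _ b)) hq1) hq2) hq3

/-! ## §3 The assembly -/

/-- **LARGE SCALES**: isotropy floor `δ`, vertical floor `c_V` at aspect `2`, approximate Harris at deficit
`δ⁴ c_V³ / 2` beyond `n₀`: for `n ≥ max n₀ 2`, `pLR S a b (2n) n ≥ δ⁴ c_V³ / 2`. -/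
theorem large {δ cV : ℝ} {n₀ : ℕ} (hδ : 0 ≤ δ) (hcV : 0 ≤ cV)
    (hI : ∀ S : Set ℤ, ∀ n : ℕ, 1 ≤ n → ∀ a b : ℤ, δ ≤ pLR S a b n n)
    (hV : ∀ (S : Set ℤ) (a b : ℤ) (w h : ℕ), 1 ≤ w → 1 ≤ h → h ≤ 2 * w → cV ≤ pTB S a b w h)
    (hH : ∀ S : Set ℤ, ∀ n : ℕ, n₀ ≤ n → ∀ a b : ℤ,
      glueProduct S n a b - δ ^ 4 * cV ^ 3 / 2 ≤ μIK.real (glueEvent S n a b))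
    (S : Set ℤ) {n : ℕ} (hn : max n₀ 2 ≤ n) (a b : ℤ) : δ ^ 4 * cV ^ 3 / 2 ≤ pLR S a b (2 * n) n := by
  haveI := CouplingToLimits.isProbabilityMeasure_μIK
  have hn2 : 2 ≤ n := le_trans (le_max_right _ _) hn
  have hprod := glueProduct_ge hδ hcV hI hV hn2 S a b
  have hharris := hH S n (le_trans (le_max_left _ _) hn) a b
  have hmono : μIK.real (glueEvent S n a b) ≤ pLR S a b (2 * n) n :=
    measureReal_mono (glueEvent_subset hn2 S a b)
  linarith

end RSWAssemblyProof

open RSWAssemblyProof in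
/-- **RSW ASSEMBLY** (strategist's STUB 3 of the ALT line `quenched-chain-fkg`, skeleton v7): the isotropy floor of
the squares and approximate Harris for the seven glue events give the horizontal clause of the crux — large scales by
the seven floors (`verticalClause_aspect 2` for the strips), approximate Harris and the planar glue, small scales by
the all-black bottom row. -/
theorem rswAssembly : RSWAssembly := by
  intro hIso hAH
  rw [Split.horizontalClause_iff]
  obtain ⟨δ, hδ, hI⟩ := hIso
  obtain ⟨cV, hcV, hV⟩ := verticalClause_aspect 2
  obtain ⟨n₀, hH⟩ := hAH (δ ^ 4 * cV ^ 3 / 2) (by positivity)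
  refine ⟨min (δ ^ 4 * cV ^ 3 / 2) ((1 / 2 : ℝ) ^ (2 * max n₀ 2)), lt_min (by positivity) (by positivity),
    fun S n hn a b => ?_⟩
  rcases Nat.lt_or_ge n (max n₀ 2) with hsmall | hlarge
  · refine (min_le_right _ _).trans (le_trans ?_ (bottomRowFloor S a b (2 * n) n (by omega) hn))
    exact pow_le_pow_of_le_one (by norm_num) (by norm_num) (by omega)
  · exact (min_le_left _ _).trans (large hδ.le hcV.le hI hV hH S hlarge a b)

/-- **STUB `stub_rswAssembly`** (registered signature; = `rswAssembly`). -/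
theorem stub_rswAssembly : RSWAssembly :=
  rswAssembly

end Summit.CriticalPhenomena.CardyFormulaZ2.Cruxes.IKMixedBoxCrossing.QuenchedChainFKG

end
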